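import Mathlib.RingTheory.Trace.Defs
import Mathlib.LinearAlgebra.Dual.Lemmas
import Mathlib.LinearAlgebra.FiniteDimensional.Lemmas
import Mathlib.LinearAlgebra.Basis.Basic
import Mathlib.LinearAlgebra.Basis.Cardinality
import Mathlib.LinearAlgebra.Dimension.StrongRankCondition
import Mathlib.LinearAlgebra.Charpoly.ToMatrix
import Mathlib.RingTheory.Artinian.Ring
import Mathlib.RingTheory.IntegralClosure.Algebra.Basic
import Mathlib.RingTheory.Polynomial.Basic
import Mathlib.FieldTheory.IsAlgClosed.Basic
import Mathlib.Data.Int.Interval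
import HarnessLib

/-!
# Lattice pairs over `k[t]`, `k[t⁻¹]`: the algebra behind "`ℙ¹` is simply connected"

Topic: `Literature/AlgebraicGeometry/FundamentalGroup`. This file is the purely algebraic core of
a proof of SGA 1, Exp. XI, Prop. 1.1 in the case `r = 1` — every connected finite étale cover
`π : Y → ℙ¹_k`, `k` algebraically closed, is an isomorphism (the named fact
`ProjectiveLineSimplyConnected` of `FundamentalGroup/ProjectiveSpace.lean`) — in the spirit of
Görtz–Wedhorn II, Thm. 20.114 (`π_* 𝒪_Y` is self-dual by the perfectness of the trace form of a
finite étale algebra, Prop. 20.71), but WITHOUT Grothendieck's splitting theorem for vector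
bundles on `ℙ¹` (Görtz–Wedhorn I, Thm. 11.53) and without Riemann–Roch / Riemann–Hurwitz (the
printed proof of SGA 1 XI 1.1): we replace both by a finite-dimensional duality count.

## The setting (Görtz–Wedhorn I, §(11.17): vector bundles on `ℙ¹` as lattice pairs)

`Λ` is a commutative `k`-algebra with a *Laurent structure* `ℓ` (`IsLaurent`: a `k`-basis
`(ℓ j)_{j ∈ ℤ}` with `ℓ i ℓ j = ℓ (i + j)`, `ℓ 0 = 1`; think `Λ = k[t, t⁻¹] = Γ(U₀ ∩ U₁, 𝒪)`,
`ℓ j = t^j`), `degGE ℓ m = t^m k[t]`, `degLE ℓ m = t^m k[t⁻¹]` are the `k`-spans of the `ℓ j`,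
`j ≥ m` resp. `j ≤ m`. `N` is a commutative `Λ`-algebra with `Λ`-bases `b`, `b'` (think
`N = Γ(π⁻¹(U₀ ∩ U₁), 𝒪_Y)`, `b` a `k[t]`-basis of `B⁺ = Γ(π⁻¹ U₀)`, `b'` a `k[t⁻¹]`-basis of
`B⁻ = Γ(π⁻¹ U₁)`), and the lattices are recovered as coordinate conditions:
`B⁺ = coordSub b (degGE ℓ 0) = ⊕ k[t] bᵢ`, `B⁻ = coordSub b' (degLE ℓ 0) = ⊕ k[t⁻¹] b'ⱼ`
(`k`-subspaces of `N`). Then `B⁺ ∩ B⁻ = Γ(Y, 𝒪_Y) = H⁰(E)` and `B⁺ ∩ t⁻¹B⁻ = H⁰(E(-1))` for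
the vector bundle `E = π_* 𝒪_Y` glued from `(B⁺, B⁻)` (Görtz–Wedhorn I, (11.17.1)).

## The argument (all proved here; our own arrangement, no single source)

Let `Tr = Tr_{N/Λ}` (`Algebra.trace Λ N`), `res` = coefficient of `ℓ (-1)`, and `β(x, y) =
res Tr(x y)` (`pairing`), a `k`-bilinear form on `N`. Hypotheses: a trace-dual family `bd` of `b`
(`Tr(bdᵢ bⱼ) = δᵢⱼ`: the trace form of `N/Λ` is perfect), self-duality
`B⁺ = {x | Tr(x B⁺) ⊆ k[t]}`, `B⁻ = {x | Tr(x B⁻) ⊆ k[t⁻¹]}` (in the application: the cover is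
étale over `U₀`, `U₁`), and `t^{1-c} bᵢ ∈ B⁻` for some `c` (`bᵢ ∈ B⁻[t] = N`).

* `eq_zero_of_forall_mem_W`: `Ann_β(B⁺ + t⁻¹B⁻) = B⁺ ∩ t⁻¹B⁻` (residue tests
  `IsLaurent.mem_degGE_zero_iff_repr`, `mem_degLE_neg_one_iff_repr` + self-duality), `= 0` if
  `H⁰(E(-1)) = 0`.
* `sup_twist_eq_top` — **`H¹(E(-1)) = 0`**, i.e. `N = B⁺ + t⁻¹B⁻`: with
  `W₀ = ⊕ (k[t] + t^{-c}k[t⁻¹]) bᵢ ⊆ W := B⁺ + t⁻¹B⁻` (`W₀_le`), `F = ⊕ (t⁻¹…t^{1-c}) bᵢ`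
  (`N = W₀ + F`, `W₀_sup_F`) and `D = ⊕ (k[t] ∩ t^{c-2}k[t⁻¹]) bdᵢ ⊆ Ann(W₀)`
  (`pairing_eq_zero_of_mem_Dsub`), the map `D → F^*` is injective (non-degeneracy of `β`,
  `eq_zero_of_forall_pairing_eq_zero`) between spaces of the same dimension `#ι (c - 1)`
  (`finrank_Dsub_eq`), hence surjective; if `W ∩ F ⊊ F`, a non-zero functional on `F` killing
  `W ∩ F` is `β(d, ·)` for some `0 ≠ d ∈ D`, and then `d ∈ Ann(W) = 0` — contradiction.
* `finrank_inf_eq_card` — **`h⁰(E) = rank E`**: the constant-term map `B⁻ → k^{ι'}` restricted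
  to `B⁺ ∩ B⁻` is injective (kernel `B⁺ ∩ t⁻¹B⁻ = 0`) and surjective (`N = B⁺ + t⁻¹B⁻`).
* `isIntegral_of_mem_inf`: `B⁺ ∩ B⁻` is integral over `k` — the characteristic polynomial of
  multiplication by `x ∈ B⁺ ∩ B⁻` has coefficients in `k[t] ∩ k[t⁻¹] = k` (computed in the bases
  `b` and `b'`; Cayley–Hamilton); with `algebraMap_surjective_of_isReduced_of_idempotent` (a
  reduced algebra with trivial idempotents, integral over `k = k̄`, is `k`) this gives
  `B⁺ ∩ B⁻ = k` from connectedness, whence `B⁺ ∩ t⁻¹B⁻ = 0` (`inf_twist_eq_bot_of_conn`) and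
* `card_le_one_of_idempotent` — **the criterion**: under the hypotheses above, if `N ≠ 0` is
  reduced, `B±` are subrings and the idempotents of `B⁺ ∩ B⁻` are trivial, the rank is `≤ 1`
  (`= dim_k (B⁺ ∩ B⁻) = dim_k k`).

Deliberately NOT here (sequel files): that a finite étale `k[t]`-algebra is free with unit
discriminant (whence the trace-dual family and self-duality), and the passage from a finite étale
`π : Y → ℙ¹_k` to this lattice data (charts of `Proj k[x₀, x₁]`, sheaf gluing, connectedness ⇒
trivial idempotents), which together discharge `ProjectiveLineSimplyConnected`.

## Sources

* A. Grothendieck, M. Raynaud, SGA 1, Exp. XI Prop. 1.1 (`π₁(ℙ¹_k) = 0`; printed proof via the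
  Hurwitz formula). [SGA1]
* U. Görtz, T. Wedhorn, *Algebraic Geometry II* (2023), Thm. 20.114 and its proof (trace form
  self-duality of `g_* 𝒪`), Prop. 20.71, Cor. 26.70. [GortzWedhorn2023]
* U. Görtz, T. Wedhorn, *Algebraic Geometry I*, 2nd ed. (2020), §(11.17), (11.17.1), Lemma 11.52,
  Thm. 11.53 (vector bundles on `ℙ¹` as `GL_n(k[t]) \ GL_n(k[t,t⁻¹]) / GL_n(k[t⁻¹])`).
  [GortzWedhorn2020]
-/

noncomputable section

open Module Submodule

namespace Literature.AlgebraicGeometry.FundamentalGroup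

/-! ## An algebra lemma: reduced, trivial idempotents, integral over `k = k̄` -/

/-- In a reduced commutative Artinian ring whose only idempotents are `0` and `1`, there is only
one maximal ideal. [folklore] -/
theorem subsingleton_maximalSpectrum_of_idempotent {S : Type*} [CommRing S] [IsArtinianRing S]
    [IsReduced S] (hidem : ∀ e : S, IsIdempotentElem e → e = 0 ∨ e = 1) :
    Subsingleton (MaximalSpectrum S) := by
  classical
  refine ⟨fun I J => ?_⟩
  by_contra hIJ
  let φ := IsArtinianRing.equivPi S
  let e : S := φ.symm (Pi.single I 1)
  have he : IsIdempotentElem e := by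
    change φ.symm (Pi.single I 1) * φ.symm (Pi.single I 1) = φ.symm (Pi.single I 1)
    rw [← map_mul]
    congr 1
    ext K
    by_cases hK : K = I
    · subst hK; simp
    · simp [hK]
  rcases hidem e he with h0 | h1
  · have : (Pi.single I 1 : ∀ K : MaximalSpectrum S, S ⧸ K.asIdeal) I = 0 := by
      have := congrArg φ h0
      simp only [e, AlgEquiv.apply_symm_apply, map_zero] at this
      rw [this]; rfl
    simp at this
  · have : (Pi.single I 1 : ∀ K : MaximalSpectrum S, S ⧸ K.asIdeal) J = 1 := by
      have := congrArg φ h1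
      simp only [e, AlgEquiv.apply_symm_apply, map_one] at this
      rw [this]; rfl
    rw [Pi.single_eq_of_ne (Ne.symm hIJ)] at this
    exact zero_ne_one this

/-- **A reduced algebra with trivial idempotents, integral over an algebraically closed field
`k`, is `k`.** If `k` is algebraically closed and `R ≠ 0` is a reduced commutative `k`-algebra,
integral over `k`, whose only idempotents are `0` and `1`, then `k → R` is surjective (hence
bijective). Proof: for `x ∈ R`, `k[x]` is a finite-dimensional reduced `k`-algebra with trivial
idempotents, hence (Artinian, product of fields with one factor) a field, finite over `k = k̄`,
so `k[x] = k`. [folklore] -/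
theorem algebraMap_surjective_of_isReduced_of_idempotent {k R : Type*} [Field k] [IsAlgClosed k]
    [CommRing R] [Algebra k R] [IsReduced R] [Nontrivial R] [Algebra.IsIntegral k R]
    (hidem : ∀ e : R, IsIdempotentElem e → e = 0 ∨ e = 1) :
    Function.Surjective (algebraMap k R) := by
  intro x
  let S := Algebra.adjoin k {x}
  have hxint : IsIntegral k x := Algebra.IsIntegral.isIntegral x
  haveI : Module.Finite k S := ⟨(Submodule.fg_top S.toSubmodule).mpr hxint.fg_adjoin_singleton⟩
  haveI : IsArtinianRing S := IsArtinianRing.of_finite k S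
  haveI : IsReduced S := isReduced_of_injective S.val Subtype.val_injective
  have hidemS : ∀ e : S, IsIdempotentElem e → e = 0 ∨ e = 1 := by
    intro e he
    rcases hidem (e : R) (by simpa [IsIdempotentElem] using congrArg Subtype.val he) with h | h
    · left; exact Subtype.ext h
    · right; exact Subtype.ext h
  haveI := subsingleton_maximalSpectrum_of_idempotent hidemS
  haveI : IsLocalRing S := by
    refine IsLocalRing.of_unique_max_ideal ?_
    obtain ⟨M, hM⟩ := Ideal.exists_maximal S
    refine ⟨M, hM, fun M' hM' => ?_⟩
    have := Subsingleton.elim (⟨M', hM'⟩ : MaximalSpectrum S) ⟨M, hM⟩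
    exact congrArg MaximalSpectrum.asIdeal this
  have hfield : IsField S := IsArtinianRing.isField_of_isReduced_of_isLocalRing S
  letI := hfield.toField
  obtain ⟨c, hc⟩ := (IsAlgClosed.algebraMap_bijective_of_isIntegral (k := k) (K := S)).2
    ⟨x, Algebra.self_mem_adjoin_singleton k x⟩
  exact ⟨c, by simpa using congrArg Subtype.val hc⟩


namespace LaurentLattice

variable {k : Type*} [Field k] {Λ : Type*} [CommRing Λ] [Algebra k Λ]

/-- A *Laurent structure* on the `k`-algebra `Λ`: a `k`-basis `ℓ` indexed by `ℤ` which is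
multiplicative, `ℓ i * ℓ j = ℓ (i + j)`, `ℓ 0 = 1` — i.e. an identification `Λ ≅ k[t, t⁻¹]` with
`ℓ j = t ^ j`. [folklore] -/
structure IsLaurent (ℓ : Basis ℤ k Λ) : Prop where
  mul : ∀ i j : ℤ, ℓ i * ℓ j = ℓ (i + j)
  zero : ℓ 0 = 1

/-- The `k`-span of the `ℓ j`, `m ≤ j` ("`t^m k[t]`"). [folklore] -/
def degGE (ℓ : Basis ℤ k Λ) (m : ℤ) : Submodule k Λ := span k (ℓ '' {j | m ≤ j})

/-- The `k`-span of the `ℓ j`, `j ≤ m` ("`t^m k[t⁻¹]`"). [folklore] -/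
def degLE (ℓ : Basis ℤ k Λ) (m : ℤ) : Submodule k Λ := span k (ℓ '' {j | j ≤ m})

/-- Membership in `degGE`: all coordinates below `m` vanish. [folklore] -/
theorem mem_degGE {ℓ : Basis ℤ k Λ} {m : ℤ} {x : Λ} :
    x ∈ degGE ℓ m ↔ ∀ j < m, ℓ.repr x j = 0 := by
  rw [degGE, ℓ.mem_span_image]
  constructor
  · intro h j hj
    by_contra hne
    exact not_le.mpr hj (h (Finsupp.mem_support_iff.mpr hne))
  · intro h j hj
    by_contra hlt
    exact (Finsupp.mem_support_iff.mp hj) (h j (not_le.mp hlt))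

/-- Membership in `degLE`: all coordinates above `m` vanish. [folklore] -/
theorem mem_degLE {ℓ : Basis ℤ k Λ} {m : ℤ} {x : Λ} :
    x ∈ degLE ℓ m ↔ ∀ j, m < j → ℓ.repr x j = 0 := by
  rw [degLE, ℓ.mem_span_image]
  constructor
  · intro h j hj
    by_contra hne
    exact not_le.mpr hj (h (Finsupp.mem_support_iff.mpr hne))
  · intro h j hj
    by_contra hlt
    exact (Finsupp.mem_support_iff.mp hj) (h j (not_le.mp hlt))

/-- `ℓ j ∈ degGE ℓ m` for `m ≤ j`. [folklore] -/
theorem self_mem_degGE (ℓ : Basis ℤ k Λ) {m j : ℤ} (h : m ≤ j) : ℓ j ∈ degGE ℓ m :=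
  subset_span ⟨j, h, rfl⟩

/-- `ℓ j ∈ degLE ℓ m` for `j ≤ m`. [folklore] -/
theorem self_mem_degLE (ℓ : Basis ℤ k Λ) {m j : ℤ} (h : j ≤ m) : ℓ j ∈ degLE ℓ m :=
  subset_span ⟨j, h, rfl⟩

/-- `degGE` is antitone in the cut-off. [folklore] -/
theorem degGE_anti (ℓ : Basis ℤ k Λ) {m m' : ℤ} (h : m ≤ m') : degGE ℓ m' ≤ degGE ℓ m :=
  span_mono (Set.image_mono fun _ hj => h.trans hj)

/-- `degLE` is monotone in the cut-off. [folklore] -/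
theorem degLE_mono (ℓ : Basis ℤ k Λ) {m m' : ℤ} (h : m ≤ m') : degLE ℓ m ≤ degLE ℓ m' :=
  span_mono (Set.image_mono fun _ hj => le_trans hj h)

/-- An element lying in every `degLE ℓ (-m)` is zero. [folklore] -/
theorem eq_zero_of_forall_mem_degLE {ℓ : Basis ℤ k Λ} {x : Λ}
    (h : ∀ m : ℕ, x ∈ degLE ℓ (-(m : ℤ))) : x = 0 := by
  apply ℓ.repr.injective
  rw [map_zero]
  ext j
  have hj := mem_degLE.mp (h (j.natAbs + 1)) j (by omega)
  simpa using hj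

/-- The strip `degGE ℓ a ⊓ degLE ℓ c` is the span of the `ℓ j`, `a ≤ j ≤ c`. [folklore] -/
theorem degGE_inf_degLE (ℓ : Basis ℤ k Λ) (a c : ℤ) :
    degGE ℓ a ⊓ degLE ℓ c = span k (ℓ '' Set.Icc a c) := by
  ext x
  rw [mem_inf, mem_degGE, mem_degLE, ℓ.mem_span_image]
  constructor
  · rintro ⟨h₁, h₂⟩ j hj
    have hne := Finsupp.mem_support_iff.mp hj
    refine ⟨?_, ?_⟩
    · by_contra h; exact hne (h₁ j (not_le.mp h))
    · by_contra h; exact hne (h₂ j (not_le.mp h))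
  · intro h
    refine ⟨fun j hj => ?_, fun j hj => ?_⟩
    · by_contra hne; exact not_le.mpr hj (h (Finsupp.mem_support_iff.mpr hne)).1
    · by_contra hne; exact not_le.mpr hj (h (Finsupp.mem_support_iff.mpr hne)).2

/-- `dim_k (degGE ℓ a ⊓ degLE ℓ c) = #[a, c]`. [folklore] -/
theorem finrank_degGE_inf_degLE (ℓ : Basis ℤ k Λ) (a c : ℤ) :
    finrank k ↥(degGE ℓ a ⊓ degLE ℓ c) = (c + 1 - a).toNat := by
  rw [degGE_inf_degLE]
  have hli : LinearIndependent k (fun j : Set.Icc a c => ℓ j) :=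
    ℓ.linearIndependent.comp _ Subtype.val_injective
  have hr : Set.range (fun j : Set.Icc a c => ℓ j) = ℓ '' Set.Icc a c := by
    ext x; simp
  have := finrank_span_eq_card hli
  rw [hr] at this
  rw [this]
  simp

/-- `Λ = (k[t] + t^{-c} k[t⁻¹]) + (strip of degrees 1-c … -1)`. [folklore] -/
theorem sup_sup_strip_eq_top (ℓ : Basis ℤ k Λ) (c : ℤ) :
    (degGE ℓ 0 ⊔ degLE ℓ (-c)) ⊔ (degGE ℓ (1 - c) ⊓ degLE ℓ (-1)) = ⊤ := by
  rw [eq_top_iff, ← ℓ.span_eq, span_le]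
  rintro _ ⟨j, rfl⟩
  by_cases h₁ : 0 ≤ j
  · exact mem_sup_left (mem_sup_left (self_mem_degGE ℓ h₁))
  by_cases h₂ : j ≤ -c
  · exact mem_sup_left (mem_sup_right (self_mem_degLE ℓ h₂))
  · exact mem_sup_right ⟨self_mem_degGE ℓ (by omega), self_mem_degLE ℓ (by omega)⟩

namespace IsLaurent

variable {ℓ : Basis ℤ k Λ} (hℓ : IsLaurent ℓ)
include hℓ

/-- `ℓ i` is a unit with inverse `ℓ (-i)`. [folklore] -/
theorem mul_neg_self (i : ℤ) : ℓ i * ℓ (-i) = 1 := by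
  rw [hℓ.mul, add_neg_cancel, hℓ.zero]

/-- `ℓ (-i) * ℓ i = 1`. [folklore] -/
theorem neg_mul_self (i : ℤ) : ℓ (-i) * ℓ i = 1 := by
  rw [hℓ.mul, neg_add_cancel, hℓ.zero]

/-- Coordinates of `ℓ i * x`: the coordinates of `x`, shifted by `i`. [folklore] -/
theorem repr_mul (i : ℤ) (x : Λ) (j : ℤ) : ℓ.repr (ℓ i * x) j = ℓ.repr x (j - i) := by
  let f₁ : Λ →ₗ[k] k := (Finsupp.lapply j) ∘ₗ (ℓ.repr : Λ →ₗ[k] ℤ →₀ k) ∘ₗ LinearMap.mulLeft k (ℓ i)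
  let f₂ : Λ →ₗ[k] k := (Finsupp.lapply (j - i)) ∘ₗ (ℓ.repr : Λ →ₗ[k] ℤ →₀ k)
  have h : f₁ = f₂ := by
    refine ℓ.ext fun m => ?_
    simp only [f₁, f₂, LinearMap.coe_comp, Function.comp_apply, LinearMap.mulLeft_apply,
      Finsupp.lapply_apply, hℓ.mul, LinearEquiv.coe_coe]
    rw [ℓ.repr_self, ℓ.repr_self, Finsupp.single_apply, Finsupp.single_apply]
    by_cases h : i + m = j
    · rw [if_pos h, if_pos (by omega)]
    · rw [if_neg h, if_neg (by omega)]
  exact congrArg (fun f : Λ →ₗ[k] k => f x) h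

/-- Multiplication by `ℓ i` shifts `degGE` by `i`. [folklore] -/
theorem mul_mem_degGE_iff (i : ℤ) {m : ℤ} {x : Λ} :
    ℓ i * x ∈ degGE ℓ (m + i) ↔ x ∈ degGE ℓ m := by
  simp only [mem_degGE, hℓ.repr_mul]
  constructor
  · intro h j hj
    simpa using h (j + i) (by omega)
  · intro h j hj
    exact h _ (by omega)

/-- Multiplication by `ℓ i` shifts `degLE` by `i`. [folklore] -/
theorem mul_mem_degLE_iff (i : ℤ) {m : ℤ} {x : Λ} :
    ℓ i * x ∈ degLE ℓ (m + i) ↔ x ∈ degLE ℓ m := by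
  simp only [mem_degLE, hℓ.repr_mul]
  constructor
  · intro h j hj
    simpa using h (j + i) (by omega)
  · intro h j hj
    exact h _ (by omega)

/-- Multiplication by `ℓ i` shifts `degGE` by `i`. [folklore] -/
theorem mul_mem_degGE {i m : ℤ} {x : Λ} (hx : x ∈ degGE ℓ m) : ℓ i * x ∈ degGE ℓ (m + i) :=
  (hℓ.mul_mem_degGE_iff i).mpr hx

/-- Multiplication by `ℓ i` shifts `degLE` by `i`. [folklore] -/
theorem mul_mem_degLE {i m : ℤ} {x : Λ} (hx : x ∈ degLE ℓ m) : ℓ i * x ∈ degLE ℓ (m + i) :=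
  (hℓ.mul_mem_degLE_iff i).mpr hx

/-- `degGE` is multiplicative: `t^m k[t] · t^{m'} k[t] ⊆ t^{m+m'} k[t]`. [folklore] -/
theorem mul_mem_degGE_of_mem {m m' : ℤ} {x y : Λ} (hx : x ∈ degGE ℓ m) (hy : y ∈ degGE ℓ m') :
    x * y ∈ degGE ℓ (m + m') := by
  induction hx using span_induction with
  | mem z hz =>
    obtain ⟨j, hj, rfl⟩ := hz
    have := hℓ.mul_mem_degGE (i := j) hy
    rw [add_comm] at this
    exact degGE_anti ℓ (by simpa using add_le_add_right (show m ≤ j from hj) m') this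
  | zero => simp
  | add z w _ _ hz hw => rw [add_mul]; exact add_mem hz hw
  | smul c z _ hz => rw [smul_mul_assoc]; exact smul_mem _ c hz

/-- `degLE` is multiplicative. [folklore] -/
theorem mul_mem_degLE_of_mem {m m' : ℤ} {x y : Λ} (hx : x ∈ degLE ℓ m) (hy : y ∈ degLE ℓ m') :
    x * y ∈ degLE ℓ (m + m') := by
  induction hx using span_induction with
  | mem z hz =>
    obtain ⟨j, hj, rfl⟩ := hz
    have := hℓ.mul_mem_degLE (i := j) hy
    rw [add_comm] at this
    exact degLE_mono ℓ (by simpa using add_le_add_right (show j ≤ m from hj) m') this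
  | zero => simp
  | add z w _ _ hz hw => rw [add_mul]; exact add_mem hz hw
  | smul c z _ hz => rw [smul_mul_assoc]; exact smul_mem _ c hz

/-- `t^m k[t⁻¹] = t^m · k[t⁻¹]`. [folklore] -/
theorem exists_eq_mul_of_mem_degLE {m : ℤ} {x : Λ} (hx : x ∈ degLE ℓ m) :
    ∃ y ∈ degLE ℓ 0, x = ℓ m * y := by
  refine ⟨ℓ (-m) * x, ?_, ?_⟩
  · have := hℓ.mul_mem_degLE (i := -m) hx
    simpa using this
  · rw [← mul_assoc, hℓ.mul_neg_self, one_mul]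

/-- Residue test for `k[t]`: `f ∈ k[t]` iff `res (t^n f) = 0` for all `n ≥ 0`. [folklore] -/
theorem mem_degGE_zero_iff_repr (f : Λ) :
    f ∈ degGE ℓ 0 ↔ ∀ n : ℕ, ℓ.repr (ℓ n * f) (-1) = 0 := by
  simp only [mem_degGE, hℓ.repr_mul]
  constructor
  · intro h n; exact h _ (by omega)
  · intro h j hj
    have := h (-1 - j).toNat
    rwa [Int.toNat_of_nonneg (by omega), show (-1 : ℤ) - (-1 - j) = j by ring] at this

/-- Residue test for `t⁻² k[t⁻¹]`: `f ∈ t⁻¹ k[t⁻¹]·t⁻¹` iff `res (t^{-n} f) = 0` for all `n ≥ 0`.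
[folklore] -/
theorem mem_degLE_neg_one_iff_repr (f : Λ) :
    f ∈ degLE ℓ (-1) ↔ ∀ n : ℕ, ℓ.repr (ℓ (-1 - n) * f) (-1) = 0 := by
  simp only [mem_degLE, hℓ.repr_mul]
  constructor
  · intro h n; exact h _ (by omega)
  · intro h j hj
    have := h j.toNat
    rwa [Int.toNat_of_nonneg (by omega), show (-1 : ℤ) - (-1 - j) = j by ring] at this

/-- The residue pairing on `Λ` is non-degenerate. [folklore] -/
theorem eq_zero_of_forall_repr_mul (f : Λ) (h : ∀ j : ℤ, ℓ.repr (ℓ j * f) (-1) = 0) : f = 0 := by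
  apply ℓ.repr.injective
  rw [map_zero]
  ext m
  have := h (-1 - m)
  rw [hℓ.repr_mul] at this
  simpa using this

omit hℓ in
/-- Scalars lie in `k[t] ∩ k[t⁻¹]`. [folklore] -/
theorem algebraMap_mem_degGE_inf_degLE (hℓ : IsLaurent ℓ) (c : k) :
    algebraMap k Λ c ∈ degGE ℓ 0 ⊓ degLE ℓ 0 := by
  rw [Algebra.algebraMap_eq_smul_one, ← hℓ.zero]
  exact smul_mem _ c ⟨self_mem_degGE ℓ le_rfl, self_mem_degLE ℓ le_rfl⟩

/-- The constant coefficient of the scalar `c`. [folklore] -/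
theorem repr_smul_one_zero (c : k) : ℓ.repr (c • (1 : Λ)) 0 = c := by
  rw [← hℓ.zero, map_smul, Basis.repr_self]; simp

/-- `1 ∈ k[t]`. [folklore] -/
theorem one_mem_degGE : (1 : Λ) ∈ degGE ℓ 0 := hℓ.zero ▸ self_mem_degGE ℓ le_rfl

/-- `1 ∈ k[t⁻¹]`. [folklore] -/
theorem one_mem_degLE : (1 : Λ) ∈ degLE ℓ 0 := hℓ.zero ▸ self_mem_degLE ℓ le_rfl

/-- `k[t] ⊆ Λ` as a `k`-subalgebra. [folklore] -/
def subalgGE : Subalgebra k Λ where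
  carrier := degGE ℓ 0
  mul_mem' ha hb := by simpa using hℓ.mul_mem_degGE_of_mem ha hb
  one_mem' := hℓ.one_mem_degGE
  add_mem' := add_mem
  zero_mem' := zero_mem _
  algebraMap_mem' c := (hℓ.algebraMap_mem_degGE_inf_degLE c).1

/-- `k[t⁻¹] ⊆ Λ` as a `k`-subalgebra. [folklore] -/
def subalgLE : Subalgebra k Λ where
  carrier := degLE ℓ 0
  mul_mem' ha hb := by simpa using hℓ.mul_mem_degLE_of_mem ha hb
  one_mem' := hℓ.one_mem_degLE
  add_mem' := add_mem
  zero_mem' := zero_mem _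
  algebraMap_mem' c := (hℓ.algebraMap_mem_degGE_inf_degLE c).2

/-- Unfolding of `subalgGE`. [folklore] -/
theorem mem_subalgGE {x : Λ} : x ∈ hℓ.subalgGE ↔ x ∈ degGE ℓ 0 := Iff.rfl

/-- Unfolding of `subalgLE`. [folklore] -/
theorem mem_subalgLE {x : Λ} : x ∈ hℓ.subalgLE ↔ x ∈ degLE ℓ 0 := Iff.rfl

/-- `k[t] ∩ k[t⁻¹] = k`. [folklore] -/
theorem exists_eq_algebraMap_of_mem_inf {x : Λ} (hx : x ∈ degGE ℓ 0 ⊓ degLE ℓ 0) :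
    ∃ c : k, x = algebraMap k Λ c := by
  rw [degGE_inf_degLE, Set.Icc_self, Set.image_singleton, hℓ.zero, mem_span_singleton] at hx
  obtain ⟨c, rfl⟩ := hx
  exact ⟨c, (Algebra.algebraMap_eq_smul_one c).symm⟩

end IsLaurent


/-! ## Lattices in a free `Λ`-module given by coordinate conditions -/

section Coord

variable (k) in
/-- The `i`-th coordinate of `x : N` in the `Λ`-basis `b`, as a `k`-linear map. [folklore] -/
def coord {N : Type*} [AddCommGroup N] [Module Λ N] [Module k N] [IsScalarTower k Λ N]
    {ι : Type*} (b : Basis ι Λ N) (i : ι) : N →ₗ[k] Λ :=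
  ((Finsupp.lapply i).comp (b.repr : N →ₗ[Λ] ι →₀ Λ)).restrictScalars k

variable {N : Type*} [AddCommGroup N] [Module Λ N] [Module k N] [IsScalarTower k Λ N]
  {ι : Type*} (b : Basis ι Λ N)

/-- Unfolding of `coord`. [folklore] -/
@[simp] theorem coord_apply (i : ι) (x : N) : coord k b i x = b.repr x i := rfl

/-- The `k`-subspace of `N` of vectors all of whose `b`-coordinates lie in `A ⊆ Λ`
(for `A = k[t]` this is the `k[t]`-lattice spanned by the basis `b`). [folklore] -/
def coordSub (A : Submodule k Λ) : Submodule k N := ⨅ i, A.comap (coord k b i)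

variable {b}

/-- Membership in `coordSub b A`: every `b`-coordinate lies in `A`. [folklore] -/
theorem mem_coordSub {A : Submodule k Λ} {x : N} : x ∈ coordSub b A ↔ ∀ i, b.repr x i ∈ A := by
  simp [coordSub, mem_iInf]

/-- `coordSub b` is monotone. [folklore] -/
theorem coordSub_mono {A A' : Submodule k Λ} (h : A ≤ A') : coordSub b A ≤ coordSub b A' :=
  fun _ hx => mem_coordSub.mpr fun i => h (mem_coordSub.mp hx i)

/-- `a • x` has coordinates `a * xᵢ`. [folklore] -/
theorem smul_mem_coordSub {A A' : Submodule k Λ} {a : Λ} (ha : ∀ y ∈ A, a * y ∈ A') {x : N}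
    (hx : x ∈ coordSub b A) : a • x ∈ coordSub b A' := by
  refine mem_coordSub.mpr fun i => ?_
  rw [map_smul, Finsupp.smul_apply, smul_eq_mul]
  exact ha _ (mem_coordSub.mp hx i)

variable [Fintype ι]

/-- Coordinates of an explicit combination of the basis. [folklore] -/
theorem repr_sum_smul (a : ι → Λ) (j : ι) : b.repr (∑ i, a i • b i) j = a j := by
  rw [← b.equivFun_symm_apply, ← b.equivFun_apply, LinearEquiv.apply_symm_apply]

/-- A combination with coefficients in `A` lies in `coordSub b A`. [folklore] -/
theorem sum_smul_mem_coordSub {A : Submodule k Λ} {a : ι → Λ} (ha : ∀ i, a i ∈ A) :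
    ∑ i, a i • b i ∈ coordSub b A :=
  mem_coordSub.mpr fun j => by rw [repr_sum_smul]; exact ha j

variable (b) in
/-- `coordSub b A ≅ A^ι` by taking coordinates. [folklore] -/
def coordSubEquiv (A : Submodule k Λ) : coordSub b A ≃ₗ[k] (ι → A) where
  toFun x := fun i => ⟨b.repr x i, mem_coordSub.mp x.2 i⟩
  map_add' x y := by ext i; simp
  map_smul' c x := by
    ext i
    simp only [Pi.smul_apply, SetLike.val_smul, RingHom.id_apply]
    rw [← algebraMap_smul Λ c (x : N), map_smul, Finsupp.smul_apply, algebraMap_smul]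
  invFun a := ⟨∑ i, (a i : Λ) • b i, sum_smul_mem_coordSub fun i => (a i).2⟩
  left_inv x := by
    apply Subtype.ext
    simp only
    exact b.sum_repr x
  right_inv a := by
    ext i
    simp only
    rw [repr_sum_smul]

/-- `dim_k coordSub b A = #ι · dim_k A`. [folklore] -/
theorem finrank_coordSub (A : Submodule k Λ) [Module.Finite k A] :
    finrank k ↥(coordSub b A) = Fintype.card ι * finrank k A := by
  rw [(coordSubEquiv b A).finrank_eq, Module.finrank_pi_fintype, Finset.sum_const, smul_eq_mul,
    Finset.card_univ]

omit [Fintype ι] in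
/-- `coordSub b Λ = N`. [folklore] -/
theorem coordSub_top : coordSub b (⊤ : Submodule k Λ) = ⊤ :=
  eq_top_iff.mpr fun _ _ => mem_coordSub.mpr fun _ => mem_top

/-- `coordSub b` commutes with sums (coordinatewise decomposition). [folklore] -/
theorem coordSub_sup (A A' : Submodule k Λ) : coordSub b (A ⊔ A') = coordSub b A ⊔ coordSub b A' := by
  refine le_antisymm ?_ (sup_le (coordSub_mono le_sup_left) (coordSub_mono le_sup_right))
  intro x hx
  have h := fun i => mem_sup.mp (mem_coordSub.mp hx i)
  choose u hu v hv huv using h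
  rw [← b.sum_repr x]
  have : ∑ i, b.repr x i • b i = ∑ i, u i • b i + ∑ i, v i • b i := by
    rw [← Finset.sum_add_distrib]
    exact Finset.sum_congr rfl fun i _ => by rw [← add_smul, huv]
  rw [this]
  exact add_mem (mem_sup_left (sum_smul_mem_coordSub hu)) (mem_sup_right (sum_smul_mem_coordSub hv))

end Coord

/-! ## The trace pairing -/

section Trace

variable {N : Type*} [CommRing N] [Algebra Λ N] [Algebra k N] [IsScalarTower k Λ N]
  {ι : Type*} [Fintype ι] [DecidableEq ι] {b : Basis ι Λ N} {bd : ι → N}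

local notation "τ" => Algebra.trace Λ N

/-- With a trace-dual family `bd` (`Tr(bdᵢ bⱼ) = δᵢⱼ`), coordinates are traces:
`xⱼ = Tr(x · bdⱼ)`. [folklore] -/
theorem repr_eq_trace_mul (hbd : ∀ i j, τ (bd i * b j) = if i = j then 1 else 0) (x : N) (j : ι) :
    b.repr x j = τ (x * bd j) := by
  conv_rhs => rw [← b.sum_repr x]
  rw [Finset.sum_mul, map_sum]
  simp only [smul_mul_assoc, map_smul, smul_eq_mul, mul_comm (b _) (bd j), hbd]
  simp

/-- … and dually `x = Σⱼ Tr(x · bⱼ) bdⱼ`: the dual family is a basis with these coordinates.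
[folklore] -/
theorem sum_trace_mul_smul (hbd : ∀ i j, τ (bd i * b j) = if i = j then 1 else 0) (x : N) :
    ∑ i, τ (x * b i) • bd i = x := by
  set z := x - ∑ i, τ (x * b i) • bd i with hz
  have h1 : ∀ m, τ (z * b m) = 0 := by
    intro m
    simp only [hz, sub_mul, map_sub, Finset.sum_mul, map_sum, smul_mul_assoc, map_smul,
      smul_eq_mul, hbd]
    simp
  have h2 : ∀ y, τ (z * y) = 0 := by
    intro y
    rw [← b.sum_repr y, Finset.mul_sum, map_sum]
    refine Finset.sum_eq_zero fun m _ => ?_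
    rw [mul_smul_comm, map_smul, h1, smul_zero]
  have h3 : z = 0 := by
    apply b.repr.injective
    rw [map_zero]
    ext j
    rw [repr_eq_trace_mul hbd, h2, Finsupp.zero_apply]
  exact (sub_eq_zero.mp h3).symm

/-- `Tr((Σ aᵢ bdᵢ) bⱼ) = aⱼ`. [folklore] -/
theorem trace_sum_smul_bd_mul (hbd : ∀ i j, τ (bd i * b j) = if i = j then 1 else 0)
    (a : ι → Λ) (j : ι) : τ ((∑ i, a i • bd i) * b j) = a j := by
  simp only [Finset.sum_mul, map_sum, smul_mul_assoc, map_smul, smul_eq_mul, hbd]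
  simp [Finset.sum_ite_eq']

end Trace

/-! ## The main argument: `H¹(E(-1)) = 0` by duality, and the count `h⁰(E) = rank E` -/

section Defs

variable {N : Type*} [CommRing N] [Algebra Λ N] [Algebra k N] [IsScalarTower k Λ N]

/-- The residue-trace pairing `β(x, y) = res (Tr_{N/Λ} (x y))`, `res` = coefficient of `ℓ (-1)`
(of `t⁻¹`). [folklore] -/
def pairing (ℓ : Basis ℤ k Λ) : N →ₗ[k] N →ₗ[k] k :=
  (LinearMap.mul k N).compr₂
    ((Finsupp.lapply (-1 : ℤ)) ∘ₗ (ℓ.repr : Λ →ₗ[k] ℤ →₀ k) ∘ₗ (Algebra.trace Λ N).restrictScalars k)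

/-- Unfolding of `pairing`. [folklore] -/
@[simp] theorem pairing_apply (ℓ : Basis ℤ k Λ) (x y : N) :
    pairing ℓ x y = ℓ.repr (Algebra.trace Λ N (x * y)) (-1) := rfl

/-- The twist `t⁻¹ B⁻ = {x | t x ∈ B⁻}` of the lattice `B⁻ = ⊕ k[t⁻¹] b'ᵢ`. [folklore] -/
def twist (ℓ : Basis ℤ k Λ) {ι' : Type*} (b' : Basis ι' Λ N) : Submodule k N :=
  (coordSub b' (degLE ℓ 0)).comap (LinearMap.mulLeft k (algebraMap Λ N (ℓ 1)))

/-- Membership in the twist `t⁻¹B⁻`. [folklore] -/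
theorem mem_twist {ℓ : Basis ℤ k Λ} {ι' : Type*} {b' : Basis ι' Λ N} {x : N} :
    x ∈ twist ℓ b' ↔ ℓ 1 • x ∈ coordSub b' (degLE ℓ 0) := by
  simp [twist, Algebra.smul_def]

/-- `D_c = {x | Tr(x bᵢ) ∈ k[t] ∩ t^{c-2} k[t⁻¹] for all i}` (`= ⊕ (k[t] ∩ t^{c-2}k[t⁻¹]) bdᵢ` for
the trace-dual basis `bd`). [folklore] -/
def Dsub (ℓ : Basis ℤ k Λ) {ι : Type*} (b : Basis ι Λ N) (c : ℕ) : Submodule k N :=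
  ⨅ i, (degGE ℓ 0 ⊓ degLE ℓ ((c : ℤ) - 2)).comap
    (((Algebra.trace Λ N).restrictScalars k) ∘ₗ LinearMap.mulRight k (b i))

/-- Membership in `D_c`. [folklore] -/
theorem mem_Dsub {ℓ : Basis ℤ k Λ} {ι : Type*} {b : Basis ι Λ N} {c : ℕ} {x : N} :
    x ∈ Dsub ℓ b c ↔ ∀ i, Algebra.trace Λ N (x * b i) ∈ degGE ℓ 0 ⊓ degLE ℓ ((c : ℤ) - 2) := by
  simp [Dsub, mem_iInf]

/-- `Tr(x · a y) = a Tr(x y)` (`Λ`-linearity of the trace). [folklore] -/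
theorem trace_mul_smul (x y : N) (a : Λ) :
    Algebra.trace Λ N (x * a • y) = a * Algebra.trace Λ N (x * y) := by
  rw [mul_smul_comm, map_smul, smul_eq_mul]

/-- `Tr(a x · y) = a Tr(x y)` (`Λ`-linearity of the trace). [folklore] -/
theorem trace_smul_mul (x y : N) (a : Λ) :
    Algebra.trace Λ N (a • x * y) = a * Algebra.trace Λ N (x * y) := by
  rw [smul_mul_assoc, map_smul, smul_eq_mul]

end Defs

section Main

variable {N : Type*} [CommRing N] [Algebra Λ N] [Algebra k N] [IsScalarTower k Λ N]
  {ι ι' : Type*} {ℓ : Basis ℤ k Λ} {b : Basis ι Λ N} {b' : Basis ι' Λ N} {bd : ι → N}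

local notation "τ" => Algebra.trace Λ N
/-- `B⁺ = ⊕ k[t] bᵢ` -/
local notation "B⁺" => coordSub b (degGE ℓ 0)
/-- `B⁻ = ⊕ k[t⁻¹] b'ᵢ` -/
local notation "B⁻" => coordSub b' (degLE ℓ 0)

variable (hℓ : IsLaurent ℓ)
include hℓ

/-- `B⁻` is a `k[t⁻¹]`-module. [folklore] -/
theorem smul_mem_Bm {a : Λ} (ha : a ∈ degLE ℓ 0) {x : N} (hx : x ∈ B⁻) : a • x ∈ B⁻ :=
  smul_mem_coordSub (fun y hy => by simpa using hℓ.mul_mem_degLE_of_mem ha hy) hx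

/-- `B⁺` is a `k[t]`-module. [folklore] -/
theorem smul_mem_Bp {a : Λ} (ha : a ∈ degGE ℓ 0) {x : N} (hx : x ∈ B⁺) : a • x ∈ B⁺ :=
  smul_mem_coordSub (fun y hy => by simpa using hℓ.mul_mem_degGE_of_mem ha hy) hx

/-- `t⁻¹ B⁻ ⊆ B⁻`. [folklore] -/
theorem mem_Bm_of_mem_twist {x : N} (hx : x ∈ twist ℓ b') : x ∈ B⁻ := by
  rw [mem_twist] at hx
  have := smul_mem_Bm hℓ (self_mem_degLE ℓ (show (-1 : ℤ) ≤ 0 by norm_num)) hx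
  rwa [smul_smul, hℓ.neg_mul_self, one_smul] at this

variable [Fintype ι] [DecidableEq ι]
  (hbd : ∀ i j, Algebra.trace Λ N (bd i * b j) = if i = j then 1 else 0)
include hbd

/-- The residue-trace pairing is non-degenerate. [folklore] -/
theorem eq_zero_of_forall_pairing_eq_zero {x : N} (h : ∀ y, pairing ℓ x y = 0) : x = 0 := by
  apply b.repr.injective
  rw [map_zero]
  ext j
  rw [repr_eq_trace_mul hbd, Finsupp.zero_apply]
  refine hℓ.eq_zero_of_forall_repr_mul _ fun m => ?_
  rw [← trace_mul_smul]
  exact h _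

variable (hdual : ∀ x, x ∈ coordSub b (degGE ℓ 0) ↔
  ∀ y ∈ coordSub b (degGE ℓ 0), Algebra.trace Λ N (x * y) ∈ degGE ℓ 0)
include hdual

omit hℓ in
/-- The dual family lies in `B⁺` (by self-duality of `B⁺`). [folklore] -/
theorem bd_mem (i : ι) : bd i ∈ B⁺ := by
  refine (hdual _).mpr fun y hy => ?_
  rw [mul_comm, ← repr_eq_trace_mul hbd]
  exact mem_coordSub.mp hy i

/-- `D_c ⊆ B⁺`. [folklore] -/
theorem Dsub_le {c : ℕ} : Dsub ℓ b c ≤ B⁺ := by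
  intro d hd
  rw [← sum_trace_mul_smul hbd d]
  exact sum_mem fun i _ => smul_mem_Bp hℓ ((mem_Dsub.mp hd i).1) (bd_mem hbd hdual i)

omit hbd hdual [DecidableEq ι] in
/-- `D_c` kills `W₀ = ⊕ (k[t] + t^{-c} k[t⁻¹]) bᵢ`. [folklore] -/
theorem pairing_eq_zero_of_mem_Dsub {c : ℕ} {d w : N} (hd : d ∈ Dsub ℓ b c)
    (hw : w ∈ coordSub b (degGE ℓ 0 ⊔ degLE ℓ (-(c : ℤ)))) : pairing ℓ d w = 0 := by
  rw [pairing_apply, ← b.sum_repr w, Finset.mul_sum, map_sum, map_sum, Finsupp.finsetSum_apply]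
  refine Finset.sum_eq_zero fun i _ => ?_
  rw [trace_mul_smul]
  obtain ⟨u, hu, v, hv, huv⟩ := mem_sup.mp (mem_coordSub.mp hw i)
  have ht := mem_Dsub.mp hd i
  rw [← huv, add_mul, map_add, Finsupp.add_apply]
  have h1 : ℓ.repr (u * τ (d * b i)) (-1) = 0 :=
    mem_degGE.mp (by simpa using hℓ.mul_mem_degGE_of_mem hu ht.1) (-1) (by norm_num)
  have h2 : ℓ.repr (v * τ (d * b i)) (-1) = 0 :=
    mem_degLE.mp (hℓ.mul_mem_degLE_of_mem hv ht.2) (-1) (by omega)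
  rw [h1, h2, add_zero]

omit hbd hdual [DecidableEq ι] in
/-- `W₀ ⊆ W = B⁺ + t⁻¹B⁻`, using `t^{1-c} bᵢ ∈ B⁻`. [folklore] -/
theorem W₀_le {c : ℕ} (hc : ∀ i, ℓ (1 - (c : ℤ)) • b i ∈ B⁻) :
    coordSub b (degGE ℓ 0 ⊔ degLE ℓ (-(c : ℤ))) ≤ B⁺ ⊔ twist ℓ b' := by
  rw [coordSub_sup]
  refine sup_le_sup_left (fun x hx => ?_) _
  rw [mem_twist, ← b.sum_repr x, Finset.smul_sum]
  refine sum_mem fun i _ => ?_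
  rw [smul_smul]
  have hxi : ℓ 1 * b.repr x i ∈ degLE ℓ (1 - (c : ℤ)) := by
    have := hℓ.mul_mem_degLE (i := 1) (mem_coordSub.mp hx i)
    rwa [show (-(c : ℤ)) + 1 = 1 - c by ring] at this
  obtain ⟨a, ha, hxa⟩ := hℓ.exists_eq_mul_of_mem_degLE hxi
  rw [hxa, mul_comm, ← smul_smul]
  exact smul_mem_Bm hℓ ha (hc i)

variable (hdual' : ∀ x, x ∈ coordSub b' (degLE ℓ 0) ↔
    ∀ y ∈ coordSub b' (degLE ℓ 0), Algebra.trace Λ N (x * y) ∈ degLE ℓ 0)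
  (hV : ∀ x ∈ coordSub b (degGE ℓ 0), ℓ 1 • x ∈ coordSub b' (degLE ℓ 0) → x = 0)
include hdual' hV

omit hbd [DecidableEq ι] [Fintype ι] in
/-- `Ann(B⁺ + t⁻¹B⁻) = B⁺ ∩ t⁻¹B⁻ = 0`. [folklore] -/
theorem eq_zero_of_forall_mem_W {x : N} (h : ∀ w ∈ B⁺ ⊔ twist ℓ b', pairing ℓ x w = 0) :
    x = 0 := by
  -- `x ∈ B⁺`
  have hx₁ : x ∈ B⁺ := by
    refine (hdual x).mpr fun y hy => (hℓ.mem_degGE_zero_iff_repr _).mpr fun n => ?_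
    rw [← trace_mul_smul]
    exact h _ (mem_sup_left (smul_mem_Bp hℓ (self_mem_degGE ℓ (by positivity)) hy))
  -- `t x ∈ B⁻`
  have hx₂ : ℓ 1 • x ∈ B⁻ := by
    refine (hdual' _).mpr fun y hy => ?_
    have hxy : τ (x * y) ∈ degLE ℓ (-1) := by
      refine (hℓ.mem_degLE_neg_one_iff_repr _).mpr fun n => ?_
      rw [← trace_mul_smul]
      refine h _ (mem_sup_right ?_)
      rw [mem_twist, smul_smul, hℓ.mul, show (1 : ℤ) + (-1 - n) = -n by ring]
      exact smul_mem_Bm hℓ (self_mem_degLE ℓ (by omega)) hy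
    rw [trace_smul_mul]
    simpa using hℓ.mul_mem_degLE (i := 1) hxy
  exact hV x hx₁ hx₂

/-! ### Dimension count: `dim D_c = dim F_c`, duality, `W = N` -/

omit hℓ hdual hdual' hV in
/-- `D_c ≅ (k[t] ∩ t^{c-2}k[t⁻¹])^ι`, `d ↦ (Tr(d bᵢ))ᵢ`, inverse `a ↦ Σ aᵢ bdᵢ`. [folklore] -/
def DsubEquiv (c : ℕ) : Dsub ℓ b c ≃ₗ[k] (ι → ↥(degGE ℓ 0 ⊓ degLE ℓ ((c : ℤ) - 2))) where
  toFun d := fun i => ⟨τ ((d : N) * b i), mem_Dsub.mp d.2 i⟩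
  map_add' x y := by
    ext i
    simp [add_mul]
  map_smul' r x := by
    ext i
    simp only [SetLike.val_smul, RingHom.id_apply, Pi.smul_apply]
    rw [smul_mul_assoc, ← algebraMap_smul Λ r, map_smul, algebraMap_smul]
  invFun a := ⟨∑ i, (a i : Λ) • bd i,
    mem_Dsub.mpr fun j => by rw [trace_sum_smul_bd_mul hbd]; exact (a j).2⟩
  left_inv d := Subtype.ext (sum_trace_mul_smul hbd (d : N))
  right_inv a := by
    ext i
    exact congrArg Subtype.val (Subtype.ext (trace_sum_smul_bd_mul hbd (fun i => (a i : Λ)) i) :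
      (⟨τ ((∑ i, (a i : Λ) • bd i) * b i), _⟩ : ↥(degGE ℓ 0 ⊓ degLE ℓ ((c : ℤ) - 2))) = a i)

omit hbd hdual hdual' hV hℓ [Fintype ι] [DecidableEq ι] in
/-- The strips `degGE ℓ a ⊓ degLE ℓ c` are finite-dimensional. [folklore] -/
theorem finite_degGE_inf_degLE (a c : ℤ) : Module.Finite k ↥(degGE ℓ a ⊓ degLE ℓ c) := by
  rw [degGE_inf_degLE]
  exact Module.Finite.span_of_finite k ((Set.finite_Icc a c).image ℓ)

omit hℓ hdual hdual' hV in
/-- `D_c` is finite-dimensional. [folklore] -/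
theorem finite_Dsub (c : ℕ) : Module.Finite k ↥(Dsub ℓ b c) :=
  haveI := finite_degGE_inf_degLE (ℓ := ℓ) 0 ((c : ℤ) - 2)
  Module.Finite.equiv (DsubEquiv hbd c).symm

omit hbd hdual hdual' hV hℓ [DecidableEq ι] in
/-- `F_c = ⊕ (strip) bᵢ` is finite-dimensional. [folklore] -/
theorem finite_F (c : ℕ) :
    Module.Finite k ↥(coordSub b (degGE ℓ (1 - (c : ℤ)) ⊓ degLE ℓ (-1))) :=
  haveI := finite_degGE_inf_degLE (ℓ := ℓ) (1 - (c : ℤ)) (-1)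
  Module.Finite.equiv (coordSubEquiv b _).symm

omit hℓ hdual hdual' hV in
/-- `dim_k D_c = dim_k F_c (= #ι · (c - 1))`. [folklore] -/
theorem finrank_Dsub_eq (c : ℕ) :
    finrank k ↥(Dsub ℓ b c) =
      finrank k ↥(coordSub b (degGE ℓ (1 - (c : ℤ)) ⊓ degLE ℓ (-1))) := by
  haveI := finite_degGE_inf_degLE (ℓ := ℓ) (1 - (c : ℤ)) (-1)
  haveI := finite_degGE_inf_degLE (ℓ := ℓ) 0 ((c : ℤ) - 2)
  rw [(DsubEquiv hbd c).finrank_eq, finrank_coordSub, Module.finrank_pi_fintype, Finset.sum_const,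
    Finset.card_univ, smul_eq_mul, finrank_degGE_inf_degLE, finrank_degGE_inf_degLE]
  congr 2
  ring

omit hbd hdual hdual' hV hℓ [DecidableEq ι] in
/-- `N = W₀ + F_c`. [folklore] -/
theorem W₀_sup_F (c : ℕ) :
    coordSub b (degGE ℓ 0 ⊔ degLE ℓ (-(c : ℤ))) ⊔
      coordSub b (degGE ℓ (1 - (c : ℤ)) ⊓ degLE ℓ (-1)) = ⊤ := by
  rw [← coordSub_sup, sup_sup_strip_eq_top, coordSub_top]

omit hbd hdual hdual' hV hℓ [Fintype ι] [DecidableEq ι] in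
/-- `D_c → F_c^*`, `d ↦ β(d, ·)`. [folklore] -/
def dualMap (c : ℕ) :
    ↥(Dsub ℓ b c) →ₗ[k] Module.Dual k ↥(coordSub b (degGE ℓ (1 - (c : ℤ)) ⊓ degLE ℓ (-1))) :=
  ((pairing ℓ).compl₂ (Submodule.subtype _)).comp (Submodule.subtype _)

omit hbd hdual hdual' hV hℓ [Fintype ι] [DecidableEq ι] in
/-- Unfolding of `dualMap`. [folklore] -/
@[simp] theorem dualMap_apply (c : ℕ) (d : ↥(Dsub ℓ b c))
    (f : ↥(coordSub b (degGE ℓ (1 - (c : ℤ)) ⊓ degLE ℓ (-1)))) :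
    dualMap c d f = pairing ℓ (d : N) (f : N) := rfl

omit hdual hdual' hV in
/-- `D_c → F_c^*` is injective: an element of `D_c` killing `F_c` kills `W₀ + F_c = N`, so vanishes by non-degeneracy of the residue-trace pairing. [folklore] -/
theorem dualMap_injective (c : ℕ) : Function.Injective (dualMap (ℓ := ℓ) (b := b) c) := by
  refine (injective_iff_map_eq_zero _).mpr fun d hd => ?_
  have h : ∀ y, pairing ℓ (d : N) y = 0 := by
    intro y
    have hy : y ∈ coordSub b (degGE ℓ 0 ⊔ degLE ℓ (-(c : ℤ))) ⊔
        coordSub b (degGE ℓ (1 - (c : ℤ)) ⊓ degLE ℓ (-1)) := by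
      rw [W₀_sup_F (ℓ := ℓ) (b := b) c]; exact mem_top
    obtain ⟨w, hw, f, hf, rfl⟩ := mem_sup.mp hy
    rw [map_add, pairing_eq_zero_of_mem_Dsub hℓ d.2 hw, zero_add]
    exact LinearMap.congr_fun hd ⟨f, hf⟩
  exact Subtype.ext (eq_zero_of_forall_pairing_eq_zero hℓ hbd h)

omit hdual hdual' hV in
/-- `D_c → F_c^*` is surjective (injective between spaces of the same finite dimension). [folklore] -/
theorem dualMap_surjective (c : ℕ) : Function.Surjective (dualMap (ℓ := ℓ) (b := b) c) := by
  haveI := finite_Dsub (ℓ := ℓ) hbd c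
  haveI := finite_F (ℓ := ℓ) (b := b) c
  refine (LinearMap.injective_iff_surjective_of_finrank_eq_finrank ?_).mp
    (dualMap_injective hℓ hbd c)
  rw [Subspace.dual_finrank_eq, finrank_Dsub_eq hbd]

/-- **`H¹(ℙ¹, E(-1)) = 0`** for the lattice pair: `N = B⁺ + t⁻¹ B⁻`. [folklore] -/
theorem sup_twist_eq_top {c : ℕ} (hc : ∀ i, ℓ (1 - (c : ℤ)) • b i ∈ coordSub b' (degLE ℓ 0)) :
    B⁺ ⊔ twist ℓ b' = ⊤ := by
  haveI := finite_F (ℓ := ℓ) (b := b) c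
  set W := B⁺ ⊔ twist ℓ b'
  set F := coordSub b (degGE ℓ (1 - (c : ℤ)) ⊓ degLE ℓ (-1)) with hFdef
  have hW₀ : coordSub b (degGE ℓ 0 ⊔ degLE ℓ (-(c : ℤ))) ≤ W := W₀_le hℓ hc
  have htop := W₀_sup_F (ℓ := ℓ) (b := b) c
  by_cases hF : W.comap F.subtype = ⊤
  · have hFW : F ≤ W := fun f hf => by
      have : (⟨f, hf⟩ : F) ∈ W.comap F.subtype := hF ▸ mem_top
      exact this
    rw [eq_top_iff, ← htop]
    exact sup_le hW₀ hFW
  · exfalso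
    obtain ⟨g, hg0, hg⟩ :=
      Submodule.exists_dual_map_eq_bot_of_lt_top (lt_top_iff_ne_top.mpr hF) inferInstance
    obtain ⟨d, hd⟩ := dualMap_surjective hℓ hbd c g
    have hdW : ∀ w ∈ W, pairing ℓ (d : N) w = 0 := by
      intro w hwW
      have hw : w ∈ coordSub b (degGE ℓ 0 ⊔ degLE ℓ (-(c : ℤ))) ⊔ F := htop ▸ mem_top
      obtain ⟨w₀, hw₀, f, hf, rfl⟩ := mem_sup.mp hw
      have hfW : f ∈ W := by
        have := sub_mem hwW (hW₀ hw₀)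
        rwa [add_sub_cancel_left] at this
      have hgf : g ⟨f, hf⟩ = 0 := by
        have : g ⟨f, hf⟩ ∈ (W.comap F.subtype).map g :=
          mem_map_of_mem (show (⟨f, hf⟩ : F) ∈ W.comap F.subtype from hfW)
        rw [hg] at this
        exact (mem_bot k).mp this
      rw [map_add, pairing_eq_zero_of_mem_Dsub hℓ d.2 hw₀, zero_add]
      rw [← hd] at hgf
      exact hgf
    have hd0 : (d : N) = 0 := eq_zero_of_forall_mem_W hℓ hdual hdual' hV hdW
    apply hg0
    rw [← hd, show d = 0 from Subtype.ext hd0, map_zero]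

/-! ### The count `dim_k (B⁺ ∩ B⁻) = rank` -/

omit hbd hdual hdual' hV hℓ [Fintype ι] [DecidableEq ι] in
variable (ℓ b') in
/-- The "constant terms" of the `b'`-coordinates: `x ↦ (coefficient of ℓ 0 in x'ᵢ)ᵢ`. [folklore] -/
def constTerm : N →ₗ[k] (ι' → k) :=
  LinearMap.pi fun i => (Finsupp.lapply (0 : ℤ)) ∘ₗ (ℓ.repr : Λ →ₗ[k] ℤ →₀ k) ∘ₗ coord k b' i

omit hbd hdual hdual' hV hℓ [Fintype ι] [DecidableEq ι] in
/-- Unfolding of `constTerm`. [folklore] -/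
@[simp] theorem constTerm_apply (x : N) (i : ι') : constTerm ℓ b' x i = ℓ.repr (b'.repr x i) 0 := rfl

omit hbd hdual hdual' hV [Fintype ι] [DecidableEq ι] in
/-- On `B⁻`, the constant terms vanish exactly on `t⁻¹B⁻`. [folklore] -/
theorem constTerm_eq_zero_iff {y : N} (hy : y ∈ B⁻) : constTerm ℓ b' y = 0 ↔ ℓ 1 • y ∈ B⁻ := by
  rw [mem_coordSub]
  simp only [map_smul, Finsupp.smul_apply, smul_eq_mul]
  have key : ∀ i, (ℓ 1 * b'.repr y i ∈ degLE ℓ 0 ↔ ℓ.repr (b'.repr y i) 0 = 0) := by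
    intro i
    rw [show (0 : ℤ) = -1 + 1 by norm_num, hℓ.mul_mem_degLE_iff, mem_degLE]
    constructor
    · intro h; exact h 0 (by norm_num)
    · intro h j hj
      rcases eq_or_lt_of_le (show (0 : ℤ) ≤ j by omega) with rfl | hj'
      · exact h
      · exact mem_degLE.mp (mem_coordSub.mp hy i) j hj'
  constructor
  · intro h i
    exact (key i).mpr (by simpa using congrFun h i)
  · intro h
    funext i
    simpa using (key i).mp (h i)

/-- **`h⁰(E) = rank E`**: `dim_k (B⁺ ∩ B⁻) = #ι'`, the common rank of the lattices — the constant
term map restricted to `B⁺ ∩ B⁻` is bijective (injective as `B⁺ ∩ t⁻¹B⁻ = 0`, surjective as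
`N = B⁺ + t⁻¹B⁻`). [folklore] -/
theorem finrank_inf_eq_card [Fintype ι'] {c : ℕ}
    (hc : ∀ i, ℓ (1 - (c : ℤ)) • b i ∈ coordSub b' (degLE ℓ 0)) :
    finrank k ↥(B⁺ ⊓ B⁻) = Fintype.card ι' := by
  let ψ : ↥(B⁺ ⊓ B⁻) →ₗ[k] (ι' → k) := (constTerm ℓ b').comp (Submodule.subtype _)
  have hinj : Function.Injective ψ := by
    refine (injective_iff_map_eq_zero _).mpr fun v hv => ?_
    have h1 : ℓ 1 • (v : N) ∈ B⁻ := (constTerm_eq_zero_iff hℓ v.2.2).mp hv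
    exact Subtype.ext (hV v v.2.1 h1)
  have hsurj : Function.Surjective ψ := by
    intro e
    set y : N := ∑ i, algebraMap k Λ (e i) • b' i with hy
    have hyB : y ∈ B⁻ := sum_smul_mem_coordSub fun i => (hℓ.algebraMap_mem_degGE_inf_degLE (e i)).2
    have hcy : constTerm ℓ b' y = e := by
      funext i
      rw [constTerm_apply, hy, repr_sum_smul, Algebra.algebraMap_eq_smul_one,
        hℓ.repr_smul_one_zero]
    have hytop : y ∈ B⁺ ⊔ twist ℓ b' := by
      rw [sup_twist_eq_top hℓ hbd hdual hdual' hV hc]; exact mem_top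
    obtain ⟨u, hu, s, hs, hus⟩ := mem_sup.mp hytop
    have hsB : s ∈ B⁻ := mem_Bm_of_mem_twist hℓ hs
    have huB : u ∈ B⁻ := by
      rw [show u = y - s from eq_sub_of_add_eq hus]
      exact sub_mem hyB hsB
    have hcs : constTerm ℓ b' s = 0 := (constTerm_eq_zero_iff hℓ hsB).mpr (mem_twist.mp hs)
    refine ⟨⟨u, hu, huB⟩, ?_⟩
    show constTerm ℓ b' u = e
    have : constTerm ℓ b' u + constTerm ℓ b' s = e := by rw [← map_add, hus, hcy]
    rwa [hcs, add_zero] at this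
  rw [(LinearEquiv.ofBijective ψ ⟨hinj, hsurj⟩).finrank_eq, Module.finrank_fintype_fun_eq_card]

/-! ### The connected case -/

omit hbd hdual hdual' hV [Fintype ι] [DecidableEq ι] in
/-- If `B⁺ ∩ B⁻ ⊆ k · 1` ("`Γ(Y, 𝒪_Y) = k`"), `B⁻` is closed under multiplication and `N ≠ 0`,
then `B⁺ ∩ t⁻¹B⁻ = 0` ("`H⁰(E(-1)) = 0`"). [folklore] -/
theorem inf_twist_eq_bot_of_conn [Nontrivial N]
    (hconn : ∀ x ∈ B⁺ ⊓ B⁻, ∃ r : k, x = algebraMap k N r)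
    (hmul : ∀ x ∈ coordSub b' (degLE ℓ 0), ∀ y ∈ coordSub b' (degLE ℓ 0),
      x * y ∈ coordSub b' (degLE ℓ 0)) :
    ∀ x ∈ B⁺, ℓ 1 • x ∈ B⁻ → x = 0 := by
  intro x hx hx1
  have hxB : x ∈ B⁻ := mem_Bm_of_mem_twist hℓ (mem_twist.mpr hx1)
  obtain ⟨r, rfl⟩ := hconn _ ⟨hx, hxB⟩
  by_contra hne
  have hr : r ≠ 0 := by
    rintro rfl
    exact hne (map_zero _)
  rw [Algebra.algebraMap_eq_smul_one] at hxB hx1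
  -- `1 ∈ B⁻` and `t • 1 ∈ B⁻`
  have h1 : (1 : N) ∈ B⁻ := (Submodule.smul_mem_iff _ hr).mp hxB
  have ht : ℓ 1 • (1 : N) ∈ B⁻ := by
    rw [← algebraMap_smul Λ r (1 : N), smul_smul, mul_comm, ← smul_smul, algebraMap_smul] at hx1
    exact (Submodule.smul_mem_iff _ hr).mp hx1
  -- hence `t^m • 1 ∈ B⁻` for all `m`
  have hpow : ∀ m : ℕ, ℓ (m : ℤ) • (1 : N) ∈ B⁻ := by
    intro m
    induction m with
    | zero => simpa [hℓ.zero] using h1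
    | succ m ih =>
      have := hmul _ ht _ ih
      rwa [smul_mul_assoc, one_mul, smul_smul, hℓ.mul, add_comm, ← Nat.cast_succ] at this
  -- so every coordinate of `1` lies in `⋂ₘ t^{-m} k[t⁻¹] = 0`
  have hzero : (1 : N) = 0 := by
    apply b'.repr.injective
    rw [map_zero]
    ext i
    rw [Finsupp.zero_apply]
    refine eq_zero_of_forall_mem_degLE (ℓ := ℓ) fun m => ?_
    have := mem_coordSub.mp (hpow m) i
    rw [map_smul, Finsupp.smul_apply, smul_eq_mul] at this
    rwa [show (0 : ℤ) = -(m : ℤ) + m by ring, hℓ.mul_mem_degLE_iff] at this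
  exact one_ne_zero hzero

omit hV in
/-- **The connected case: the rank is at most one.** If `B⁺ ∩ B⁻ ⊆ k · 1`, `B⁻` is closed under
multiplication and `N ≠ 0`, then the common rank `#ι'` of the lattices is `≤ 1`. [folklore] -/
theorem card_le_one [Fintype ι'] [Nontrivial N]
    (hconn : ∀ x ∈ B⁺ ⊓ B⁻, ∃ r : k, x = algebraMap k N r)
    (hmul : ∀ x ∈ coordSub b' (degLE ℓ 0), ∀ y ∈ coordSub b' (degLE ℓ 0),
      x * y ∈ coordSub b' (degLE ℓ 0))
    {c : ℕ} (hc : ∀ i, ℓ (1 - (c : ℤ)) • b i ∈ coordSub b' (degLE ℓ 0)) :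
    Fintype.card ι' ≤ 1 := by
  have hV := inf_twist_eq_bot_of_conn hℓ (b := b) (b' := b') hconn hmul
  rw [← finrank_inf_eq_card hℓ hbd hdual hdual' hV hc]
  have hle : B⁺ ⊓ B⁻ ≤ span k {(1 : N)} := fun x hx => by
    obtain ⟨r, rfl⟩ := hconn x hx
    rw [Algebra.algebraMap_eq_smul_one]
    exact smul_mem _ r (subset_span rfl)
  calc finrank k ↥(B⁺ ⊓ B⁻) ≤ finrank k ↥(span k {(1 : N)}) := Submodule.finrank_mono hle
    _ ≤ 1 := by simpa using finrank_span_le_card ({1} : Set N)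

omit hbd hdual hdual' hV [DecidableEq ι] [Algebra k N] [IsScalarTower k Λ N] in
/-- The two lattices have the same rank (`Λ` has invariant basis number). [folklore] -/
theorem card_eq_card [Fintype ι'] (b : Basis ι Λ N) (b' : Basis ι' Λ N) :
    Fintype.card ι = Fintype.card ι' := by
  haveI : Nontrivial Λ := nontrivial_of_ne 1 0 (hℓ.zero ▸ ℓ.ne_zero 0)
  exact Fintype.card_congr (b.indexEquiv b')

/-! ### `B⁺ ∩ B⁻` is integral over `k` (characteristic polynomials in the two bases) -/

omit hbd hdual hdual' hV [Fintype ι] [DecidableEq ι] in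
/-- The basis vectors `bⱼ` lie in `B⁺`. [folklore] -/
theorem basis_mem_Bp (j : ι) : b j ∈ B⁺ :=
  mem_coordSub.mpr fun i => by
    classical
    rw [b.repr_self, Finsupp.single_apply]
    split_ifs
    · exact hℓ.one_mem_degGE
    · exact zero_mem _

omit hbd hdual hdual' hV [Fintype ι] [DecidableEq ι] in
/-- The basis vectors `b'ⱼ` lie in `B⁻`. [folklore] -/
theorem basis_mem_Bm (j : ι') : b' j ∈ B⁻ :=
  mem_coordSub.mpr fun i => by
    classical
    rw [b'.repr_self, Finsupp.single_apply]
    split_ifs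
    · exact hℓ.one_mem_degLE
    · exact zero_mem _

omit hbd hdual hdual' hV in
/-- The characteristic polynomial of multiplication by `x ∈ B⁺` has coefficients in `k[t]`
(computed in the `k[t]`-basis `b` of `B⁺`). [folklore] -/
theorem coeff_charpoly_mem_degGE [Module.Free Λ N] [Module.Finite Λ N]
    (hmul : ∀ x ∈ B⁺, ∀ y ∈ B⁺, x * y ∈ B⁺) {x : N} (hx : x ∈ B⁺)
    (n : ℕ) : (Algebra.lmul Λ N x).charpoly.coeff n ∈ degGE ℓ 0 := by
  let M : Matrix ι ι hℓ.subalgGE :=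
    Matrix.of fun i j => ⟨b.repr (x * b j) i, mem_coordSub.mp (hmul x hx _ (basis_mem_Bp hℓ j)) i⟩
  have hM : M.map hℓ.subalgGE.val = Algebra.leftMulMatrix b x := by
    ext i j
    simp [M, Algebra.leftMulMatrix_eq_repr_mul]
  have hp : (Algebra.lmul Λ N x).charpoly = M.charpoly.map hℓ.subalgGE.val.toRingHom := by
    rw [← LinearMap.charpoly_toMatrix _ b, ← Algebra.leftMulMatrix_apply, ← hM]
    exact Matrix.charpoly_map M hℓ.subalgGE.val.toRingHom
  rw [hp, Polynomial.coeff_map]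
  exact (M.charpoly.coeff n).2

omit hbd hdual hdual' hV [Fintype ι] [DecidableEq ι] in
/-- … and in `k[t⁻¹]` for `x ∈ B⁻`. [folklore] -/
theorem coeff_charpoly_mem_degLE [Fintype ι'] [DecidableEq ι'] [Module.Free Λ N] [Module.Finite Λ N]
    (hmul' : ∀ x ∈ B⁻, ∀ y ∈ B⁻, x * y ∈ B⁻) {x : N} (hx : x ∈ B⁻)
    (n : ℕ) : (Algebra.lmul Λ N x).charpoly.coeff n ∈ degLE ℓ 0 := by
  let M : Matrix ι' ι' hℓ.subalgLE :=
    Matrix.of fun i j => ⟨b'.repr (x * b' j) i, mem_coordSub.mp (hmul' x hx _ (basis_mem_Bm hℓ j)) i⟩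
  have hM : M.map hℓ.subalgLE.val = Algebra.leftMulMatrix b' x := by
    ext i j
    simp [M, Algebra.leftMulMatrix_eq_repr_mul]
  have hp : (Algebra.lmul Λ N x).charpoly = M.charpoly.map hℓ.subalgLE.val.toRingHom := by
    rw [← LinearMap.charpoly_toMatrix _ b', ← Algebra.leftMulMatrix_apply, ← hM]
    exact Matrix.charpoly_map M hℓ.subalgLE.val.toRingHom
  rw [hp, Polynomial.coeff_map]
  exact (M.charpoly.coeff n).2

omit hbd hdual hdual' hV in
/-- **`B⁺ ∩ B⁻` is integral over `k`**: for `x ∈ B⁺ ∩ B⁻` the characteristic polynomial of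
multiplication by `x` on `N` has coefficients in `k[t] ∩ k[t⁻¹] = k`, and kills `x`
(Cayley–Hamilton). [folklore] -/
theorem isIntegral_of_mem_inf [Fintype ι'] [DecidableEq ι']
    (hmul : ∀ x ∈ B⁺, ∀ y ∈ B⁺, x * y ∈ B⁺) (hmul' : ∀ x ∈ B⁻, ∀ y ∈ B⁻, x * y ∈ B⁻)
    {x : N} (hx : x ∈ B⁺ ⊓ B⁻) : IsIntegral k x := by
  haveI := Module.Free.of_basis b
  haveI := Module.Finite.of_basis b
  haveI : Nontrivial Λ := nontrivial_of_ne 1 0 (hℓ.zero ▸ ℓ.ne_zero 0)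
  set p : Polynomial Λ := (Algebra.lmul Λ N x).charpoly with hp
  have hcoef : ∀ n, ∃ c : k, p.coeff n = algebraMap k Λ c := fun n =>
    hℓ.exists_eq_algebraMap_of_mem_inf
      ⟨coeff_charpoly_mem_degGE hℓ hmul hx.1 n, coeff_charpoly_mem_degLE hℓ hmul' hx.2 n⟩
  have hlifts : p ∈ Polynomial.lifts (algebraMap k Λ) :=
    (Polynomial.lifts_iff_coeff_lifts p).mpr fun n => by
      obtain ⟨c, hc⟩ := hcoef n
      exact ⟨c, hc.symm⟩
  obtain ⟨q, hq, -, hqm⟩ :=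
    Polynomial.lifts_and_degree_eq_and_monic hlifts (hp ▸ LinearMap.charpoly_monic _)
  refine ⟨q, hqm, ?_⟩
  have h1 : Polynomial.aeval x p = 0 := by
    have := LinearMap.aeval_self_charpoly (Algebra.lmul Λ N x)
    rw [← hp, Polynomial.aeval_algHom_apply (Algebra.lmul Λ N) x p] at this
    simpa using congrArg (fun f : Module.End Λ N => f 1) this
  rw [← Polynomial.aeval_def, ← Polynomial.aeval_map_algebraMap Λ, hq, h1]

/-! ### The final criterion -/

omit hV in
/-- **Lattice form of "`ℙ¹` is simply connected"**: if `k` is algebraically closed, `N ≠ 0` is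
reduced, `B⁺` and `B⁻` are closed under multiplication and contain `1`, the only idempotents of
`B⁺ ∩ B⁻` are `0` and `1` (connectedness), `B⁺` and `B⁻` are self-dual for the trace form
(étaleness over `k[t]` and `k[t⁻¹]`) with a trace-dual basis (étaleness over `k[t, t⁻¹]`), and
the `bᵢ` lie in `B⁻[t]`, then the rank is `≤ 1`. [folklore] -/
theorem card_le_one_of_idempotent [Fintype ι'] [DecidableEq ι'] [IsAlgClosed k] [IsReduced N]
    [Nontrivial N]
    (hidem : ∀ e ∈ B⁺ ⊓ B⁻, IsIdempotentElem e → e = 0 ∨ e = 1)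
    (hmul : ∀ x ∈ B⁺, ∀ y ∈ B⁺, x * y ∈ B⁺)
    (hmul' : ∀ x ∈ coordSub b' (degLE ℓ 0), ∀ y ∈ coordSub b' (degLE ℓ 0),
      x * y ∈ coordSub b' (degLE ℓ 0))
    (hone : (1 : N) ∈ B⁺) (hone' : (1 : N) ∈ B⁻)
    {c : ℕ} (hc : ∀ i, ℓ (1 - (c : ℤ)) • b i ∈ coordSub b' (degLE ℓ 0)) :
    Fintype.card ι' ≤ 1 := by
  let S : Subalgebra k N :=
    { carrier := ↑(B⁺ ⊓ B⁻)
      mul_mem' := fun ha hb => ⟨hmul _ ha.1 _ hb.1, hmul' _ ha.2 _ hb.2⟩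
      one_mem' := ⟨hone, hone'⟩
      add_mem' := fun ha hb => add_mem ha hb
      zero_mem' := zero_mem _
      algebraMap_mem' := fun r => by
        rw [Algebra.algebraMap_eq_smul_one]
        exact smul_mem _ r ⟨hone, hone'⟩ }
  have hS : ∀ {x : N}, x ∈ S ↔ x ∈ B⁺ ⊓ B⁻ := Iff.rfl
  haveI : IsReduced S := isReduced_of_injective S.val Subtype.val_injective
  haveI : Nontrivial S := ⟨⟨0, 1, fun h => zero_ne_one (congrArg Subtype.val h)⟩⟩
  haveI : Algebra.IsIntegral k S := ⟨fun s =>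
    (isIntegral_algHom_iff S.val Subtype.val_injective).mp
      (isIntegral_of_mem_inf hℓ hmul hmul' (hS.mp s.2))⟩
  have hidemS : ∀ e : S, IsIdempotentElem e → e = 0 ∨ e = 1 := by
    intro e he
    rcases hidem (e : N) (hS.mp e.2) (by simpa [IsIdempotentElem] using congrArg Subtype.val he)
      with h | h
    · exact Or.inl (Subtype.ext h)
    · exact Or.inr (Subtype.ext h)
  have hsurj := algebraMap_surjective_of_isReduced_of_idempotent (k := k) hidemS
  refine card_le_one hℓ hbd hdual hdual' (fun x hx => ?_) hmul' hc
  obtain ⟨r, hr⟩ := hsurj ⟨x, hS.mpr hx⟩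
  exact ⟨r, by simpa using (congrArg Subtype.val hr).symm⟩

end Main

end LaurentLattice

end Literature.AlgebraicGeometry.FundamentalGroup
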